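import Summits.Parity.GeneralizedHardyLittlewood.Theorems.PrimeLevelFamEdgeMomentsBeyondDiagonalDiagDecorWeightGeneric
import Summits.Parity.GeneralizedHardyLittlewood.Theorems.PrimeLevelFamEdgeMomentsBeyondDiagonalDiagBoseOuter
import HarnessLib

/-!
# Route `PrimeLevelFamEdge`, crux K_A `MomentsBeyondDiagonal` (stmt-Parity-20007), line «petersson_layers» v4, stub `stub_diag`:
# **the order-`(i,j)` decorated Selberg form AFTER the Hecke summation, exactly, for EVERY order `(i,j)`**

Generic version of `…DiagDecorOrderOneOneHecke` (p825764, order `(1,1)`). In the decorated Selberg coordinates of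
`…DiagOrderSelberg.subDiag_of_selbergOrderAsymptotics` the order-`(i,j)` weight is the Hecke sum
`Σ_{d∣k₁}Σ_{e∣k₂} 𝔚_{ij}(log(Q/n₁), log(Q/n₂); n₁n₂/Q²)`, `𝔚_{ij}(A₁,A₂;y) = ∫_{u₁>0}(A₁+log u₁)^i∫_{u₂>y/u₁}B(u₁+u₂)(A₂+log u₂)^j`,
`n₁ = (k₁/d)(ge)`, `n₂ = (gd)(k₂/e)`, `n₁n₂ = g²k₁k₂`. By `…DiagBoseOuter.bose_expand`
(`𝔚_{ij} = Σ_{a≤i,b≤j}C(i,a)C(j,b)A₁^{i−a}A₂^{j−b}c_{ab}(y)`) and the generic weight algebra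
`…DiagDecorWeightGeneric.inner_weight_A1_pow_A2_pow`, for ALL `(i,j)` and all `k₁, k₂ ≥ 1`:

  `Σ_{d,e}𝔚_{ij} = Σ_{a≤i}Σ_{b≤j} C(i,a)C(j,b) · W_{i−a,j−b}(L; k₁,k₂) · c_{ab}(g²k₁k₂/Q²)`,

  `W_{p,q}(L;k₁,k₂) = 2^{−(p+q)}Σ_{r≤p}Σ_{s≤q}C(p,r)C(q,s)(−1)^s L^{(p−r)+(q−s)} Σ_{t≤r+s}C(r+s,t)·M_t(k₁)·M_{r+s−t}(k₂)`,

`L = 2(log Q − log g) − log k₁ − log k₂`, `M_t(k) = Σ_{d∣k}(2log d − log k)^t` (`M_odd = 0`; `M_0 = τ`, `M_2 = τP₂` on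
squarefree `k`), `c_{ab}(y) = ∫_{u₁>0}log^a u₁∫_{u₂>y/u₁}B log^b u₂` the Bose coefficients:

* `heckeSum_order_eq` — the pointwise identity (`Q > 0`, `g, k₁, k₂ ≥ 1`; no squarefree hypothesis needed);
* `selbergOrder_hecke_eq` — **the exact identity of Selberg forms, every `(i,j)`** (`Q > 0`, any `M`, `N`): the left side is
  literally the inner Selberg form of the target `h` of `subDiag_of_selbergOrderAsymptotics` (with `Q = q̂`, `M = q̂^{Δ′}`,
  `N = ⌊M⌋`), the right side a Selberg form whose weight is a finite combination of the SEPARABLE monomials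
  `M_t(k₁)·M_{t′}(k₂)·L^m·c_{ab}(g²k₁k₂/Q²)` — the input format of the two-sided decorated β+ℓ⁺ blocks
  (`…DiagDecorShiftedBlockDecor*`) once `c_{ab} = Π_{ab}(L) + E_{ab} + r_{ab}` (`…DiagBoseMixedStructure`) is inserted.

At `(i,j) = (1,1)` this is `selbergOrderOneOne_hecke_eq` (there `W₀₀ = ττ`, `W₁₀ = W₀₁ = ττL/2`, `W₁₁ = ττ(L²−ΣP₂)/4`).
Def-free; theorems only. Helper `--supports stmt-Parity-20007`; closes nothing; K_A, K_B and the Parity summit are NOT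
proved; nothing about Landau–Siegel zeros.

## References
* E. Kowalski, P. Michel, J. VanderKam, J. reine angew. Math. 526 (2000), (21)–(28) pp. 12–15.
  [cite: KowalskiMichelVanderKam2000, (23)–(28) — derivation (Hecke-divisor bookkeeping of the order-(i,j) diagonal weight)]
-/

noncomputable section

open scoped Real ArithmeticFunction.Moebius
open Finset ArithmeticFunction Polynomial MeasureTheory Set

namespace Summit.Parity.GeneralizedHardyLittlewood.Theorems.MomentsBeyondDiagonal.DiagKernel

open Literature.NumberTheory.LFunctions Literature.NumberTheory.LFunctions.KMV2000
open Summit.Parity.GeneralizedHardyLittlewood.Theorems.MomentsBeyondDiagonal.DiagLines (bose_expand)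

/-- Four nested finite sums: the two outer ones move past the two inner ones. [folklore] -/
private theorem sum_sum_sum_sum_comm' {α β γ δ : Type*} (A : Finset α) (B : Finset β) (C : Finset γ) (D : Finset δ)
    (F : α → β → γ → δ → ℝ) :
    ∑ a ∈ A, ∑ b ∈ B, ∑ c ∈ C, ∑ d ∈ D, F a b c d = ∑ c ∈ C, ∑ d ∈ D, ∑ a ∈ A, ∑ b ∈ B, F a b c d := by
  calc ∑ a ∈ A, ∑ b ∈ B, ∑ c ∈ C, ∑ d ∈ D, F a b c d
      = ∑ a ∈ A, ∑ c ∈ C, ∑ b ∈ B, ∑ d ∈ D, F a b c d := Finset.sum_congr rfl fun _ _ ↦ Finset.sum_comm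
    _ = ∑ c ∈ C, ∑ a ∈ A, ∑ b ∈ B, ∑ d ∈ D, F a b c d := Finset.sum_comm
    _ = ∑ c ∈ C, ∑ a ∈ A, ∑ d ∈ D, ∑ b ∈ B, F a b c d :=
        Finset.sum_congr rfl fun _ _ ↦ Finset.sum_congr rfl fun _ _ ↦ Finset.sum_comm
    _ = ∑ c ∈ C, ∑ d ∈ D, ∑ a ∈ A, ∑ b ∈ B, F a b c d := Finset.sum_congr rfl fun _ _ ↦ Finset.sum_comm

/-- `n₁n₂/Q² > 0` for the Selberg variables `n₁ = (k₁/d)(ge)`, `n₂ = (gd)(k₂/e)` (`Q > 0`, `g, k₁, k₂ ≥ 1`, `d ∣ k₁`,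
`e ∣ k₂`). [folklore] -/
theorem n1n2_div_sq_pos {Q : ℝ} (hQ : 0 < Q) {g k₁ k₂ d e : ℕ} (hg : g ≠ 0) (hk₁ : k₁ ≠ 0) (hk₂ : k₂ ≠ 0)
    (hd : d ∈ k₁.divisors) (he : e ∈ k₂.divisors) :
    0 < ((k₁ / d * (g * e) * (g * d * (k₂ / e)) : ℕ) : ℝ) / Q ^ 2 := by
  rw [n1_mul_n2_eq g hd he]
  have h : 0 < g * g * (k₁ * k₂) := by positivity
  have h' : (0 : ℝ) < ((g * g * (k₁ * k₂) : ℕ) : ℝ) := by exact_mod_cast h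
  positivity

/-- **The Hecke sum of the order-`(i,j)` weight, pointwise, for every `(i,j)`** (`Q > 0`, `g, k₁, k₂ ≥ 1`):
`Σ_{d∣k₁}Σ_{e∣k₂}𝔚_{ij}(log(Q/n₁),log(Q/n₂);n₁n₂/Q²) = Σ_{a≤i,b≤j} C(i,a)C(j,b)·W_{i−a,j−b}(L;k₁,k₂)·c_{ab}(g²k₁k₂/Q²)`
(see the module docstring for `W_{p,q}` and `c_{ab}`). [cite: KowalskiMichelVanderKam2000, (23)–(28) — derivation] -/
theorem heckeSum_order_eq (i j : ℕ) {Q : ℝ} (hQ : 0 < Q) {g k₁ k₂ : ℕ} (hg : g ≠ 0) (hk₁ : k₁ ≠ 0) (hk₂ : k₂ ≠ 0) :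
    ∑ d ∈ k₁.divisors, ∑ e ∈ k₂.divisors,
        ∫ u₁ in Ioi (0 : ℝ),
          (Real.log (Q / ((k₁ / d * (g * e) : ℕ) : ℝ)) + Real.log u₁) ^ i *
          ∫ u₂ in Ioi ((((k₁ / d * (g * e) * (g * d * (k₂ / e)) : ℕ) : ℝ) / Q ^ 2) / u₁),
            Real.exp (-(u₁ + u₂)) / (1 - Real.exp (-(u₁ + u₂))) ^ 2 *
            (Real.log (Q / ((g * d * (k₂ / e) : ℕ) : ℝ)) + Real.log u₂) ^ j =
      ∑ a ∈ range (i + 1), ∑ b ∈ range (j + 1),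
        (i.choose a : ℝ) * (j.choose b) *
          ((1 / 2) ^ ((i - a) + (j - b)) * ∑ r ∈ range (i - a + 1), ∑ s ∈ range (j - b + 1),
            ((i - a).choose r : ℝ) * ((j - b).choose s) * (-1) ^ s *
                (2 * (Real.log Q - Real.log g) - Real.log k₁ - Real.log k₂) ^ ((i - a) - r + ((j - b) - s)) *
              ∑ t ∈ range (r + s + 1), ((r + s).choose t : ℝ) *
                ((∑ d ∈ k₁.divisors, (2 * Real.log d - Real.log k₁) ^ t) *
                  ∑ e ∈ k₂.divisors, (2 * Real.log e - Real.log k₂) ^ (r + s - t))) *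
          ∫ u₁ in Ioi (0 : ℝ), Real.log u₁ ^ a *
            ∫ u₂ in Ioi ((((g * g * (k₁ * k₂) : ℕ) : ℝ) / Q ^ 2) / u₁),
              Real.exp (-(u₁ + u₂)) / (1 - Real.exp (-(u₁ + u₂))) ^ 2 * Real.log u₂ ^ b := by
  -- Step 1: pointwise Bose expansion of every summand
  rw [Finset.sum_congr rfl fun d hd ↦ Finset.sum_congr rfl fun e he ↦
    bose_expand (n1n2_div_sq_pos hQ hg hk₁ hk₂ hd he) i j _ _]
  -- Step 2: move the `(a,b)` sums out
  rw [sum_sum_sum_sum_comm']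
  refine Finset.sum_congr rfl fun a _ ↦ Finset.sum_congr rfl fun b _ ↦ ?_
  -- Step 3: the generic weight algebra with the `(d,e)`-free factor `c_{ab}(n₁n₂/Q²)`
  have hH := inner_weight_A1_pow_A2_pow
    (fun K : ℕ ↦ ∫ u₁ in Ioi (0 : ℝ), Real.log u₁ ^ a *
      ∫ u₂ in Ioi (((K : ℝ) / Q ^ 2) / u₁), Real.exp (-(u₁ + u₂)) / (1 - Real.exp (-(u₁ + u₂))) ^ 2 * Real.log u₂ ^ b)
    hQ hg k₁ k₂ (i - a) (j - b)
  rw [Finset.sum_congr rfl fun d _ ↦ Finset.sum_congr rfl fun e _ ↦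
    show (i.choose a : ℝ) * (j.choose b : ℝ) * Real.log (Q / ((k₁ / d * (g * e) : ℕ) : ℝ)) ^ (i - a) *
          Real.log (Q / ((g * d * (k₂ / e) : ℕ) : ℝ)) ^ (j - b) *
        (∫ u₁ in Ioi (0 : ℝ), Real.log u₁ ^ a *
          ∫ u₂ in Ioi ((((k₁ / d * (g * e) * (g * d * (k₂ / e)) : ℕ) : ℝ) / Q ^ 2) / u₁),
            Real.exp (-(u₁ + u₂)) / (1 - Real.exp (-(u₁ + u₂))) ^ 2 * Real.log u₂ ^ b) =
      (i.choose a : ℝ) * (j.choose b : ℝ) * (Real.log (Q / ((k₁ / d * (g * e) : ℕ) : ℝ)) ^ (i - a) *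
          Real.log (Q / ((g * d * (k₂ / e) : ℕ) : ℝ)) ^ (j - b) *
        (fun K : ℕ ↦ ∫ u₁ in Ioi (0 : ℝ), Real.log u₁ ^ a *
          ∫ u₂ in Ioi (((K : ℝ) / Q ^ 2) / u₁), Real.exp (-(u₁ + u₂)) / (1 - Real.exp (-(u₁ + u₂))) ^ 2 *
            Real.log u₂ ^ b) (k₁ / d * (g * e) * (g * d * (k₂ / e)))) by ring]
  simp_rw [← Finset.mul_sum]
  rw [hH]
  ring

/-- **The order-`(i,j)` decorated Selberg form after the Hecke summation, exactly, for every `(i,j)`** (`Q > 0`, any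
`M`, `N`; see the module docstring: the weight becomes a finite combination of the separable monomials
`M_t(k₁)M_{t′}(k₂)L^m·c_{ab}(g²k₁k₂/Q²)`). [cite: KowalskiMichelVanderKam2000, (23)–(28) — derivation] -/
theorem selbergOrder_hecke_eq (i j : ℕ) (P : ℝ[X]) (M : ℝ) (N : ℕ) {Q : ℝ} (hQ : 0 < Q) :
    ∑ c ∈ Icc 1 N, ∑ g ∈ Icc 1 (N / c), (μ g : ℝ) * c *
        ∑ k₁ ∈ Icc 1 (N / (c * g)), ∑ k₂ ∈ Icc 1 (N / (c * g)),
          ((μ (c * g * k₁) : ℝ) * ((psi (c * g * k₁))⁻¹ *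
              P.eval (Real.log (M / ((c * g * k₁ : ℕ) : ℝ)) / Real.log M)) / ((c * g * k₁ : ℕ) : ℝ)) *
            ((μ (c * g * k₂) : ℝ) * ((psi (c * g * k₂))⁻¹ *
              P.eval (Real.log (M / ((c * g * k₂ : ℕ) : ℝ)) / Real.log M)) / ((c * g * k₂ : ℕ) : ℝ)) *
            ∑ d ∈ k₁.divisors, ∑ e ∈ k₂.divisors,
              ∫ u₁ in Ioi (0 : ℝ),
                (Real.log (Q / ((k₁ / d * (g * e) : ℕ) : ℝ)) + Real.log u₁) ^ i *
                ∫ u₂ in Ioi ((((k₁ / d * (g * e) * (g * d * (k₂ / e)) : ℕ) : ℝ) / Q ^ 2) / u₁),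
                  Real.exp (-(u₁ + u₂)) / (1 - Real.exp (-(u₁ + u₂))) ^ 2 *
                  (Real.log (Q / ((g * d * (k₂ / e) : ℕ) : ℝ)) + Real.log u₂) ^ j =
      ∑ c ∈ Icc 1 N, ∑ g ∈ Icc 1 (N / c), (μ g : ℝ) * c *
        ∑ k₁ ∈ Icc 1 (N / (c * g)), ∑ k₂ ∈ Icc 1 (N / (c * g)),
          ((μ (c * g * k₁) : ℝ) * ((psi (c * g * k₁))⁻¹ *
              P.eval (Real.log (M / ((c * g * k₁ : ℕ) : ℝ)) / Real.log M)) / ((c * g * k₁ : ℕ) : ℝ)) *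
            ((μ (c * g * k₂) : ℝ) * ((psi (c * g * k₂))⁻¹ *
              P.eval (Real.log (M / ((c * g * k₂ : ℕ) : ℝ)) / Real.log M)) / ((c * g * k₂ : ℕ) : ℝ)) *
            ∑ a ∈ range (i + 1), ∑ b ∈ range (j + 1),
              (i.choose a : ℝ) * (j.choose b) *
                ((1 / 2) ^ ((i - a) + (j - b)) * ∑ r ∈ range (i - a + 1), ∑ s ∈ range (j - b + 1),
                  ((i - a).choose r : ℝ) * ((j - b).choose s) * (-1) ^ s *
                      (2 * (Real.log Q - Real.log g) - Real.log k₁ - Real.log k₂) ^ ((i - a) - r + ((j - b) - s)) *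
                    ∑ t ∈ range (r + s + 1), ((r + s).choose t : ℝ) *
                      ((∑ d ∈ k₁.divisors, (2 * Real.log d - Real.log k₁) ^ t) *
                        ∑ e ∈ k₂.divisors, (2 * Real.log e - Real.log k₂) ^ (r + s - t))) *
                ∫ u₁ in Ioi (0 : ℝ), Real.log u₁ ^ a *
                  ∫ u₂ in Ioi ((((g * g * (k₁ * k₂) : ℕ) : ℝ) / Q ^ 2) / u₁),
                    Real.exp (-(u₁ + u₂)) / (1 - Real.exp (-(u₁ + u₂))) ^ 2 * Real.log u₂ ^ b := by
  refine Finset.sum_congr rfl fun c _ ↦ Finset.sum_congr rfl fun g hg ↦ ?_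
  congr 1
  refine Finset.sum_congr rfl fun k₁ hk₁ ↦ Finset.sum_congr rfl fun k₂ hk₂ ↦ ?_
  have hg0 : g ≠ 0 := by have := (Finset.mem_Icc.1 hg).1; omega
  have hk₁0 : k₁ ≠ 0 := by have := (Finset.mem_Icc.1 hk₁).1; omega
  have hk₂0 : k₂ ≠ 0 := by have := (Finset.mem_Icc.1 hk₂).1; omega
  rw [heckeSum_order_eq i j hQ hg0 hk₁0 hk₂0]

end Summit.Parity.GeneralizedHardyLittlewood.Theorems.MomentsBeyondDiagonal.DiagKernel

end
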